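import Mathlib
import HarnessLib
import Summits.HubbardSuperconductivity.HubbardSuperconductivity.Theorems.KLProgrammeKLRegimeTwoVolumeLipJumpRows

/-!
# Route `KLProgramme` — crux K3 ENGINE (stmt-HubbardSuperconductivity-20437), stub (e) proof-input «(e)-D-ROWS», G-1 FOLDED INTO THE CHAIN: THE SOURCE TRANSFER
# AND THE RE-MEASURED SUMMAND WITH ALL GEOMETRY ROWS DISCHARGED
# (seat hubbard-kl-k3c4-p1 g23; `--supports` 20437; DROWS-SCOPE-g23 v5 §9.4 G-1)

`…LipJumpRows.klJump_transfer_le_of_scaleWtRows` is the canonical deep-pin transfer door for the jump matrices with periodisation, block covariance, the nine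
geometry rows and the triangle discharged.  Here it is read at the two places the (D) rows use it, so that the block chain
(`…LipSourceTransfer.sum_pinned_norm_kernel_klLipBornDiff_le_of_parts`, `…LipRemeasure.sum_pinned_norm_kernel_klLipInputDiff_le_of_parts`) carries only
E1-currency data: `klScaleWt`-weighted row / column sums of the fine transfer matrices, one-volume profiles, and the two-volume defect / difference profiles.

* `lipSourceTransfer_le_of_scaleWtRows` — the SRC term of block `k` (the `h₂` of `…klLipBornDiff_le_of_parts`), `klLipTransfer = klJump (dk) (dk−1)` (`rfl`).
* `lipRemeasureSummand_le_of_scaleWtRows` — the re-measured summand of block `k′ < k` (the `h k′` of `…klLipInputDiff_le_of_parts`), defect = `klLipBornDiff … k′`.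

Compositions of landed theorems; nothing asserts the (D) rows, stub (e), VL, K3 or superconductivity.
References: BGM 2006 §2.7 (2.71), §3 (3.2)–(3.8) [cite: BenfattoGiulianiMastropietro2006].
-/

namespace Summit.HubbardSuperconductivity.HubbardSuperconductivity.Theorems.TwoVolumeLip

set_option linter.dupNamespace false -- summit = problem name (single-conjunct summit), D-0017

open Finset Literature.MathematicalPhysics.QuantumLattice GrassmannAlgebra Literature.Probability.LatticeModels
open Literature.MathematicalPhysics.QuantumLattice.FermiRG
open Summit.HubbardSuperconductivity.HubbardSuperconductivity.Theorems.KLRegimeSplit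
open Summit.HubbardSuperconductivity.HubbardSuperconductivity.Theorems.KLProgrammeLegKernels
open Summit.HubbardSuperconductivity.HubbardSuperconductivity.Theorems.DispersionFlow
open Summit.HubbardSuperconductivity.HubbardSuperconductivity.Theorems.EngineV8
open Summit.HubbardSuperconductivity.HubbardSuperconductivity.Theorems.TwoVolumeSource
open Summit.HubbardSuperconductivity.HubbardSuperconductivity.Theorems.TwoVolumeDefect

noncomputable section

variable {L b M : ℕ} [NeZero L] [NeZero (b * L)] [NeZero M]

/-- **F-D4c, rows discharged** — `…LipSourceTransfer.lipSourceTransfer_le` with the nine geometry rows, the triangle, the periodisation and the block covariance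
of the block transfer `klLipTransfer (bL) = klJump (bL) (dk) (dk−1)` DISCHARGED: named are only E1's `klScaleWt`-weighted row / column sums of `klLipTransfer (bL)`
(`≤ cW`, rate `j_r`, `Λ_T ≤ Λ_{j_r}`), the coarse born profiles `N`, `N_far`, and the source-defect profiles `E` (pins within `r` of the deep pin; `…LipDefectStep.lipSourceDefect_le`),
`ND`. -/
theorem lipSourceTransfer_le_of_scaleWtRows {β : ℝ} (hβ : 0 < β) (U μ : ℝ) (K : TrigPolyC4v) {d k : ℕ} (hdk : 1 ≤ d * k) (jr : ℕ)
    (hZc : hubbardEffPartitionFnCT L M β U μ 0 K (klScale klE0 (d * k)) ≠ 0)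
    {ΛT cW : ℝ} (hΛT : 0 ≤ ΛT) (hΛr : ΛT ≤ klScale klE0 jr) (hcW : 0 ≤ cW)
    (hrow : ∀ x, ∑ y', ‖klLipTransfer (b * L) M β μ K d k x y'‖ *
      klScaleWt (b * L) M β jr {latticeLegPos (2 * (2 * M)) x, latticeLegPos (2 * (2 * M)) y'} ≤ cW)
    (hcol : ∀ y', ∑ x, ‖klLipTransfer (b * L) M β μ K d k x y'‖ *
      klScaleWt (b * L) M β jr {latticeLegPos (2 * (2 * M)) x, latticeLegPos (2 * (2 * M)) y'} ≤ cW)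
    {n : ℕ} (p : Fin (n + 1)) (w' : SpaceTimeIdx (b * L) M × SectorLeg (sectorCount (d * k))) (D₀ r : ℕ) (hD₀ : 2 * r ≤ D₀)
    (hw : ∀ i, D₀ + r ≤ (w'.1.2 i).val % L ∧ (w'.1.2 i).val % L + (D₀ + r) < L)
    {N Nfar E ND : ℝ} (hN0 : 0 ≤ N) (hNfar0 : 0 ≤ Nfar) (hE0 : 0 ≤ E) (hND0 : 0 ≤ ND)
    (hN : ∀ y, ∑ Y ∈ univ.filter (fun Y : Fin (n + 1) → SpaceTimeIdx L M × SectorLeg (sectorCount (d * k - 1)) => Y p = y), ‖kernel ℂ (effAction ℂ (klLipCov L M β μ K d k) (klLipInput L M β U μ K d k) - klLipInput L M β U μ K d k) (n + 1) Y‖ ≤ N)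
    (hNfar : ∀ y (i : Fin (n + 1)),
      ∑ Y ∈ univ.filter (fun Y : Fin (n + 1) → SpaceTimeIdx L M × SectorLeg (sectorCount (d * k - 1)) => Y p = y ∧ r < Torus.tnorm ((Y p).1.2 - (Y i).1.2)),
        ‖kernel ℂ (effAction ℂ (klLipCov L M β μ K d k) (klLipInput L M β U μ K d k) - klLipInput L M β U μ K d k) (n + 1) Y‖ ≤ Nfar)
    (hE : ∀ y' : SpaceTimeIdx (b * L) M × SectorLeg (sectorCount (d * k - 1)), Torus.tnorm (w'.1.2 - y'.1.2) ≤ r →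
      ∑ Y' ∈ univ.filter (fun Y' : Fin (n + 1) → SpaceTimeIdx (b * L) M × SectorLeg (sectorCount (d * k - 1)) => Y' p = y'),
        ‖kernel ℂ ((effAction ℂ (klLipCov (b * L) M β μ K d k) (klGlue L b M (sectorCount (d * k - 1)) (klLipInput L M β U μ K d k)) -
              klGlue L b M (sectorCount (d * k - 1)) (klLipInput L M β U μ K d k)) -
            klGlue L b M (sectorCount (d * k - 1))
              (effAction ℂ (klLipCov L M β μ K d k) (klLipInput L M β U μ K d k) - klLipInput L M β U μ K d k)) (n + 1) Y'‖ ≤ E)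
    (hND : ∀ y', ∑ Y' ∈ univ.filter (fun Y' : Fin (n + 1) → SpaceTimeIdx (b * L) M × SectorLeg (sectorCount (d * k - 1)) => Y' p = y'),
      ‖kernel ℂ ((effAction ℂ (klLipCov (b * L) M β μ K d k) (klGlue L b M (sectorCount (d * k - 1)) (klLipInput L M β U μ K d k)) -
              klGlue L b M (sectorCount (d * k - 1)) (klLipInput L M β U μ K d k)) -
            klGlue L b M (sectorCount (d * k - 1))
              (effAction ℂ (klLipCov L M β μ K d k) (klLipInput L M β U μ K d k) - klLipInput L M β U μ K d k)) (n + 1) Y'‖ ≤ ND) :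
    ∑ X' ∈ univ.filter (fun X' : Fin (n + 1) → SpaceTimeIdx (b * L) M × SectorLeg (sectorCount (d * k)) => X' p = w'),
        ‖kernel ℂ (ExteriorAlgebra.map (Matrix.toLin' (klLipTransfer (b * L) M β μ K d k))
              (effAction ℂ (klLipCov (b * L) M β μ K d k) (klGlue L b M (sectorCount (d * k - 1)) (klLipInput L M β U μ K d k)) -
                klGlue L b M (sectorCount (d * k - 1)) (klLipInput L M β U μ K d k)) -
            klGlue L b M (sectorCount (d * k)) (klLipBorn L M β U μ K d k)) (n + 1) X'‖ ≤
      cW ^ n * (cW * E + cW / (1 + ΛT * ((r : ℝ) + 1)) * ND) +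
        (2 * cW ^ n * (cW / (1 + ΛT * ((r : ℝ) + 1))) * N + n * cW ^ n * (5 * (cW / (1 + ΛT * ((r : ℝ) + 1))) * N + 2 * cW * Nfar)) := by
  rw [klLipBorn_eq_map_klLipTransfer_born (V := L) hβ.ne' U μ K hdk hZc]
  exact klJump_transfer_le_of_scaleWtRows hβ μ K (d * k) (d * k - 1) jr hΛT hΛr hcW hrow hcol _ _ p w' D₀ r hD₀ hw hN0 hNfar0 hE0 hND0 hN hNfar hE hND

/-- **F-D6 summand, rows discharged** — `…LipRemeasure.lipRemeasureSummand_le` with the nine geometry rows, the triangle, the periodisation and the block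
covariance of the jump matrix DISCHARGED (`klJump_transfer_le_of_scaleWtRows`): named are only E1's `klScaleWt`-weighted row / column sums of
`klJump (bL) … (dk−1) (dk′)` (`≤ cW`, rate `j_r`, `Λ_T ≤ Λ_{j_r}`), the coarse born profiles `N`, `N_far` of block `k′`, and the born-DIFFERENCE profiles `E` (pins
within `r` of the deep pin), `ND` of block `k′`. -/
theorem lipRemeasureSummand_le_of_scaleWtRows {β : ℝ} (hβ : 0 < β) (U μ : ℝ) (K : TrigPolyC4v) (d k k' jr : ℕ)
    {ΛT cW : ℝ} (hΛT : 0 ≤ ΛT) (hΛr : ΛT ≤ klScale klE0 jr) (hcW : 0 ≤ cW)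
    (hrow : ∀ x, ∑ y', ‖klJump (b * L) M β μ K (d * k - 1) (d * k') x y'‖ *
      klScaleWt (b * L) M β jr {latticeLegPos (2 * (2 * M)) x, latticeLegPos (2 * (2 * M)) y'} ≤ cW)
    (hcol : ∀ y', ∑ x, ‖klJump (b * L) M β μ K (d * k - 1) (d * k') x y'‖ *
      klScaleWt (b * L) M β jr {latticeLegPos (2 * (2 * M)) x, latticeLegPos (2 * (2 * M)) y'} ≤ cW)
    {n : ℕ} (p : Fin (n + 1)) (w' : SpaceTimeIdx (b * L) M × SectorLeg (sectorCount (d * k - 1))) (D₀ r : ℕ) (hD₀ : 2 * r ≤ D₀)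
    (hw : ∀ i, D₀ + r ≤ (w'.1.2 i).val % L ∧ (w'.1.2 i).val % L + (D₀ + r) < L)
    {N Nfar E ND : ℝ} (hN0 : 0 ≤ N) (hNfar0 : 0 ≤ Nfar) (hE0 : 0 ≤ E) (hND0 : 0 ≤ ND)
    (hN : ∀ y, ∑ Y ∈ univ.filter (fun Y : Fin (n + 1) → SpaceTimeIdx L M × SectorLeg (sectorCount (d * k')) => Y p = y), ‖kernel ℂ (klLipBorn L M β U μ K d k') (n + 1) Y‖ ≤ N)
    (hNfar : ∀ y (i : Fin (n + 1)),
      ∑ Y ∈ univ.filter (fun Y : Fin (n + 1) → SpaceTimeIdx L M × SectorLeg (sectorCount (d * k')) => Y p = y ∧ r < Torus.tnorm ((Y p).1.2 - (Y i).1.2)),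
        ‖kernel ℂ (klLipBorn L M β U μ K d k') (n + 1) Y‖ ≤ Nfar)
    (hE : ∀ y' : SpaceTimeIdx (b * L) M × SectorLeg (sectorCount (d * k')), Torus.tnorm (w'.1.2 - y'.1.2) ≤ r →
      ∑ Y' ∈ univ.filter (fun Y' : Fin (n + 1) → SpaceTimeIdx (b * L) M × SectorLeg (sectorCount (d * k')) => Y' p = y'),
        ‖kernel ℂ (klLipBornDiff L b M β U μ K d k') (n + 1) Y'‖ ≤ E)
    (hND : ∀ y', ∑ Y' ∈ univ.filter (fun Y' : Fin (n + 1) → SpaceTimeIdx (b * L) M × SectorLeg (sectorCount (d * k')) => Y' p = y'),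
      ‖kernel ℂ (klLipBornDiff L b M β U μ K d k') (n + 1) Y'‖ ≤ ND) :
    ∑ X' ∈ univ.filter (fun X' : Fin (n + 1) → SpaceTimeIdx (b * L) M × SectorLeg (sectorCount (d * k - 1)) => X' p = w'),
        ‖kernel ℂ (ExteriorAlgebra.map (Matrix.toLin' (klJump (b * L) M β μ K (d * k - 1) (d * k'))) (klLipBorn (b * L) M β U μ K d k') -
            klGlue L b M (sectorCount (d * k - 1))
              (ExteriorAlgebra.map (Matrix.toLin' (klJump L M β μ K (d * k - 1) (d * k'))) (klLipBorn L M β U μ K d k'))) (n + 1) X'‖ ≤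
      cW ^ n * (cW * E + cW / (1 + ΛT * ((r : ℝ) + 1)) * ND) +
        (2 * cW ^ n * (cW / (1 + ΛT * ((r : ℝ) + 1))) * N + n * cW ^ n * (5 * (cW / (1 + ΛT * ((r : ℝ) + 1))) * N + 2 * cW * Nfar)) := by
  refine klJump_transfer_le_of_scaleWtRows hβ μ K (d * k - 1) (d * k') jr hΛT hΛr hcW hrow hcol (klLipBorn (b * L) M β U μ K d k')
    (klLipBorn L M β U μ K d k') p w' D₀ r hD₀ hw hN0 hNfar0 hE0 hND0 hN hNfar (fun y' hy' => ?_) (fun y' => ?_)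
  · rw [← klLipBornDiff_def]; exact hE y' hy'
  · rw [← klLipBornDiff_def]; exact hND y'

end

end Summit.HubbardSuperconductivity.HubbardSuperconductivity.Theorems.TwoVolumeLip
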